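import Mathlib.MeasureTheory.Constructions.Polish.StronglyMeasurable
import Mathlib.MeasureTheory.Function.Floor
import Mathlib.MeasureTheory.Function.SpecialFunctions.Basic
import Mathlib.Analysis.SpecialFunctions.Pow.Continuity
import Mathlib.Topology.Order.DenselyOrdered
import Literature.Probability.RandomPlanarGeometry.SLEAdaptedProofs
import Literature.Probability.RandomPlanarGeometry.LoewnerAdaptedPlane
import Literature.Probability.RandomPlanarGeometry.LoewnerMapProofs
import Literature.Probability.RandomPlanarGeometry.LoewnerPointFlow
import HarnessLib

/-!
# The Cardy observable of SLE_κ is adapted (discharge of `stronglyAdapted_cardyObservable`)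

Topic `Probability/RandomPlanarGeometry`; theorems only, sorry-free. This file proves

* **`Literature.Probability.RandomPlanarGeometry.stronglyAdapted_cardyObservable_holds`**: for
  *every* `κ : ℝ≥0` and *every* mark vector `x : Fin 3 → ℝ`, the Cardy observable
  `cardyObservable κ x` of `SLEMartingale` (crit-perc.S22) is strongly adapted to the raw
  Brownian filtration `𝓕ᵂ` (`brownianFiltration`).

Recall (`SLEMartingale`) that `cardyObservable κ x t ω` is `F(ηₜ)` for `t < T(ω)` (Cardy's
function `F = cardyFunction` of the cross-ratio `ηₜ` of `Wₜ, gₜ(x₀), gₜ(x₁), gₜ(x₂)`; `T` the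
first swallowing time of a mark) and, for `t ≥ T(ω)`, the *left limit* `lim_{s ↑ T} F(η_s)` in
the sense of Mathlib's `Filter.limUnder` (a junk value when the limit does not exist). Lawler
(2005), §4.1 and §6.2: `gₜ(x)`, `T_x` and hence the observable are functionals of the driving
function up to time `t`; Revuz–Yor (1999), Ch. I §4 (hitting times and limits of adapted
processes with regular paths).

## The proof

On `{t < T} ∈ 𝓕ᵂ_t` (`T` is an `𝓕ᵂ`-stopping time, `isStoppingTime_swallowingStoppingTime_holds`)
the observable is `F ∘ ηₜ` with `ηₜ` `𝓕ᵂ_t`-measurable (`SLEAdaptedProofs.measurable_realFlow_sle`: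
the real Loewner flow is a measurable functional of the stopped path; after swallowing
`Loewner.map` takes the documented junk value `x`) and `F` Borel
(`CardyAdapted.measurable_cardyFunction`: a `tsum` of polynomials times a real power).

The substance is the `else` branch: the measurability of the left limit
`ω ↦ limUnder (𝓝[<] T(ω)) (F ∘ η(ω))` *including its junk values*, for **all** mark vectors —
also the degenerate ones for which `η ∉ (0, 1)` and `F = cardyFunction` is merely Borel (it
vanishes identically for `|η| > 1`, where the hypergeometric series diverges, and jumps at
`η = ±1`). This is the general lemma `LeftLimitAtTime.measurable_limUnder_nhdsLT_comp`: for a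
measurable time `τ`, paths `g ω` continuous on `[0, τ ω)` and measurable at fixed times, and
`F` Borel and continuous off a countable set `Z`, the map `ω ↦ limUnder (𝓝[<] τ ω) (F ∘ g ω)` is
measurable. Its proof: the event "the left limit exists" is described by a *countable Cauchy
criterion* (`LeftLimitAtTime.exists_tendsto_comp_iff`) over *witnesses* of the values of `F ∘ g`
on the windows `(τ - 1/(m+1), τ)` — rational times in the window, and exceptional values
`z ∈ Z` attained by the path there (an event made countable by the intermediate value theorem,
`LeftLimitAtTime.exists_window_eq_iff`, `LeftLimitAtTime.forall_window_lt_iff`); on that event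
the limit is the limit of the samples at the dyadic times `(⌈τ2ᵏ⌉ - 1)/2ᵏ ↑ τ`
(`MeasureTheory.StronglyMeasurable.limUnder`), elsewhere `limUnder` is a constant. The paths
`s ↦ η_s(ω)` are continuous on `[0, T(ω))` (`CardyAdapted.continuousOn_cardyCrossRatio`: the real
flow is continuous in time, stays off the driving function (`IsSolution.ne`), and is injective,
`Loewner.injOn_map_of_lt_swallowingTime`), and `cardyFunction` is continuous off `{1, -1}`
(`CardyAdapted.continuousAt_cardyFunction`).

## References

* G. F. Lawler, *Conformally Invariant Processes in the Plane*, AMS (2005), §4.1, §6.2.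
* G. F. Lawler, O. Schramm, W. Werner, *Values of Brownian intersection exponents I*,
  Acta Math. 187 (2001), §3.
* D. Revuz, M. Yor, *Continuous Martingales and Brownian Motion* (1999), Ch. I §4.
-/

noncomputable section

open Set Filter MeasureTheory Topology
open scoped NNReal

namespace Literature.Probability.RandomPlanarGeometry

namespace LeftLimitAtTime

/-! ### Rational times, shrinking windows and dyadic sampling times in `ℝ≥0`

No auxiliary definitions are introduced (this is a proof file): the *rational time* of `q : ℚ` is
`(q : ℝ).toNNReal`, the `m`-th *window* at `τ₀` is `Ioo (τ₀ - (m+1)⁻¹) τ₀` (truncated subtraction,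
so windows never contain `0`), and the `k`-th *dyadic sampling time* before `τ₀` is
`((⌈τ₀ 2ᵏ⌉ - 1) / 2ᵏ).toNNReal ∈ [τ₀ - 2⁻ᵏ, τ₀)`. -/

/-- Between two distinct nonnegative reals there is a rational time. [folklore] -/
theorem exists_ratTime_btwn {u v : ℝ≥0} (h : u < v) :
    ∃ q : ℚ, u < ((q : ℝ)).toNNReal ∧ ((q : ℝ)).toNNReal < v := by
  obtain ⟨q, hq1, hq2⟩ := exists_rat_btwn (NNReal.coe_lt_coe.2 h)
  have hq0 : (0 : ℝ) ≤ q := u.coe_nonneg.trans hq1.le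
  refine ⟨q, ?_, ?_⟩
  · rw [← NNReal.coe_lt_coe, Real.coe_toNNReal _ hq0]; exact hq1
  · rw [← NNReal.coe_lt_coe, Real.coe_toNNReal _ hq0]; exact hq2

/-- Rational times are dense in `ℝ≥0`. [folklore] -/
theorem dense_range_ratTime : Dense (range fun q : ℚ ↦ ((q : ℝ)).toNNReal) :=
  dense_iff_exists_between.2 fun _ _ h ↦
    let ⟨q, h1, h2⟩ := exists_ratTime_btwn h
    ⟨_, ⟨q, rfl⟩, h1, h2⟩

/-- `(m + 1)⁻¹` in `ℝ≥0` coerces to `(m + 1)⁻¹` in `ℝ`. [folklore] -/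
theorem coe_eps (m : ℕ) : ((((m : ℝ≥0) + 1)⁻¹ : ℝ≥0) : ℝ) = ((m : ℝ) + 1)⁻¹ := by
  push_cast
  ring

/-- A window of positive width at a positive time is a left neighbourhood. [folklore] -/
theorem window_mem_nhdsLT {τ₀ δ : ℝ≥0} (hτ₀ : 0 < τ₀) (hδ : 0 < δ) : Ioo (τ₀ - δ) τ₀ ∈ 𝓝[<] τ₀ :=
  Ioo_mem_nhdsLT (tsub_lt_self hτ₀ hδ)

/-- Every left neighbourhood of a positive time contains one of the windows of width
`1 / (m + 1)`. [folklore] -/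
theorem exists_window_subset {τ₀ : ℝ≥0} (hτ₀ : 0 < τ₀) {t : Set ℝ≥0} (ht : t ∈ 𝓝[<] τ₀) :
    ∃ m : ℕ, Ioo (τ₀ - ((m : ℝ≥0) + 1)⁻¹) τ₀ ⊆ t := by
  obtain ⟨l, hl, hlt⟩ := (mem_nhdsLT_iff_exists_Ioo_subset' hτ₀).1 ht
  have hl' : (l : ℝ) < τ₀ := NNReal.coe_lt_coe.2 hl
  obtain ⟨m, hm⟩ := exists_nat_one_div_lt (sub_pos.2 hl')
  refine ⟨m, fun s hs ↦ hlt ⟨?_, hs.2⟩⟩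
  have h1 : ((((m : ℝ≥0) + 1)⁻¹ : ℝ≥0) : ℝ) < τ₀ - l := by rw [coe_eps]; rwa [one_div] at hm
  have hle : ((m : ℝ≥0) + 1)⁻¹ ≤ τ₀ := by
    rw [← NNReal.coe_le_coe]; linarith [l.coe_nonneg]
  have h2 : l ≤ τ₀ - ((m : ℝ≥0) + 1)⁻¹ := by
    rw [← NNReal.coe_le_coe, NNReal.coe_sub hle]; linarith
  exact lt_of_le_of_lt h2 hs.1

/-- The dyadic sampling time `((⌈τ₀ 2ᵏ⌉ - 1) / 2ᵏ)⁺` is strictly before a positive time `τ₀`.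
[folklore] -/
theorem dyTime_lt (k : ℕ) {τ₀ : ℝ≥0} (hτ₀ : 0 < τ₀) :
    ((((⌈(τ₀ : ℝ) * 2 ^ k⌉ : ℤ) : ℝ) - 1) / 2 ^ k).toNNReal < τ₀ := by
  have h2 : (0 : ℝ) < 2 ^ k := by positivity
  have hτ₀' : (0 : ℝ) < τ₀ := hτ₀
  rw [← NNReal.coe_lt_coe]
  have hceil := Int.ceil_lt_add_one ((τ₀ : ℝ) * 2 ^ k)
  rcases le_or_gt 0 ((((⌈(τ₀ : ℝ) * 2 ^ k⌉ : ℤ) : ℝ) - 1) / 2 ^ k) with h | h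
  · rw [Real.coe_toNNReal _ h, div_lt_iff₀ h2]; linarith
  · rw [Real.toNNReal_of_nonpos h.le]; exact hτ₀'

/-- The dyadic sampling time is within `2⁻ᵏ` of `τ₀`. [folklore] -/
theorem sub_le_dyTime (k : ℕ) (τ₀ : ℝ≥0) :
    (τ₀ : ℝ) - (2 ^ k)⁻¹ ≤ ((((⌈(τ₀ : ℝ) * 2 ^ k⌉ : ℤ) : ℝ) - 1) / 2 ^ k).toNNReal := by
  have h2 : (0 : ℝ) < 2 ^ k := by positivity
  refine le_trans ?_ (Real.le_coe_toNNReal _)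
  rw [le_div_iff₀ h2, sub_mul, inv_mul_cancel₀ h2.ne']
  linarith [Int.le_ceil ((τ₀ : ℝ) * 2 ^ k)]

/-- The dyadic sampling times converge to `τ₀ > 0` from the left. [folklore] -/
theorem tendsto_dyTime {τ₀ : ℝ≥0} (hτ₀ : 0 < τ₀) :
    Tendsto (fun k : ℕ ↦ ((((⌈(τ₀ : ℝ) * 2 ^ k⌉ : ℤ) : ℝ) - 1) / 2 ^ k).toNNReal)
      atTop (𝓝[<] τ₀) := by
  refine tendsto_nhdsWithin_iff.2 ⟨?_, Eventually.of_forall fun k ↦ dyTime_lt k hτ₀⟩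
  rw [← NNReal.tendsto_coe]
  have hlow : Tendsto (fun k : ℕ ↦ (τ₀ : ℝ) - (2 ^ k)⁻¹) atTop (𝓝 (τ₀ : ℝ)) := by
    have h : Tendsto (fun k : ℕ ↦ ((2 : ℝ) ^ k)⁻¹) atTop (𝓝 0) := by
      simpa only [← inv_pow] using
        tendsto_pow_atTop_nhds_zero_of_lt_one (by norm_num : (0 : ℝ) ≤ 2⁻¹) (by norm_num)
    simpa using tendsto_const_nhds.sub h
  exact tendsto_of_tendsto_of_tendsto_of_le_of_le hlow tendsto_const_nhds
    (fun k ↦ sub_le_dyTime k τ₀) (fun k ↦ NNReal.coe_le_coe.2 (dyTime_lt k hτ₀).le)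

/-! ### Countable descriptions of path events on a window -/

section Window

variable {τ₀ δ : ℝ≥0} {g₀ : ℝ≥0 → ℝ}

/-- For a path continuous before `τ₀`, "`g₀ < z` on the window" is a countable condition on the
values of `g₀` at rational times: on every rational subinterval the values stay a definite amount
below `z`. [folklore] -/
theorem forall_window_lt_iff (hc : ContinuousOn g₀ (Iio τ₀)) (z : ℝ) :
    (∀ s ∈ Ioo (τ₀ - δ) τ₀, g₀ s < z) ↔
      ∀ a b : ℚ, ((a : ℝ)).toNNReal ∈ Ioo (τ₀ - δ) τ₀ → ((b : ℝ)).toNNReal ∈ Ioo (τ₀ - δ) τ₀ →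
        ∃ k : ℕ, ∀ q : ℚ, ((q : ℝ)).toNNReal ∈ Icc ((a : ℝ)).toNNReal ((b : ℝ)).toNNReal →
          g₀ ((q : ℝ)).toNNReal ≤ z - ((k : ℝ) + 1)⁻¹ := by
  constructor
  · intro h a b ha hb
    set K := Icc ((a : ℝ)).toNNReal ((b : ℝ)).toNNReal with hK
    have hKw : K ⊆ Ioo (τ₀ - δ) τ₀ := fun s hs ↦ ⟨ha.1.trans_le hs.1, hs.2.trans_lt hb.2⟩
    by_cases hne : K.Nonempty
    · obtain ⟨s₀, hs₀, hmax⟩ := isCompact_Icc.exists_isMaxOn hne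
        (hc.mono (hKw.trans fun _ h ↦ h.2))
      have hlt : g₀ s₀ < z := h s₀ (hKw hs₀)
      obtain ⟨k, hk⟩ := exists_nat_one_div_lt (sub_pos.2 hlt)
      refine ⟨k, fun q hq ↦ ?_⟩
      have h1 : g₀ ((q : ℝ)).toNNReal ≤ g₀ s₀ := hmax hq
      rw [one_div] at hk
      linarith
    · exact ⟨0, fun q hq ↦ (hne ⟨_, hq⟩).elim⟩
  · intro h s hs
    obtain ⟨a, ha1, ha2⟩ := exists_ratTime_btwn hs.1
    obtain ⟨b, hb1, hb2⟩ := exists_ratTime_btwn hs.2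
    obtain ⟨k, hk⟩ := h a b ⟨ha1, ha2.trans hs.2⟩ ⟨hs.1.trans hb1, hb2⟩
    have hsc : ContinuousAt g₀ s := hc.continuousAt (Iio_mem_nhds hs.2)
    have hcl : s ∈ closure (Ioo ((a : ℝ)).toNNReal ((b : ℝ)).toNNReal ∩
        range fun q : ℚ ↦ ((q : ℝ)).toNNReal) :=
      dense_range_ratTime.open_subset_closure_inter isOpen_Ioo ⟨ha2, hb1⟩
    have hmem := hsc.continuousWithinAt.mem_closure_image hcl
    have hsub : g₀ '' (Ioo ((a : ℝ)).toNNReal ((b : ℝ)).toNNReal ∩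
        range fun q : ℚ ↦ ((q : ℝ)).toNNReal) ⊆ Iic (z - ((k : ℝ) + 1)⁻¹) := by
      rintro _ ⟨d, ⟨hd, q, rfl⟩, rfl⟩
      exact hk q ⟨hd.1.le, hd.2.le⟩
    have h1 : g₀ s ≤ z - ((k : ℝ) + 1)⁻¹ := by
      have := closure_mono hsub hmem
      rwa [closure_Iic] at this
    have h2 : (0 : ℝ) < ((k : ℝ) + 1)⁻¹ := by positivity
    linarith

/-- For a path continuous before `τ₀`, the value `z` is attained on the window iff the path is
neither everywhere below nor everywhere above `z` there (intermediate value theorem).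
[folklore] -/
theorem exists_window_eq_iff (hc : ContinuousOn g₀ (Iio τ₀)) (z : ℝ) :
    (∃ s ∈ Ioo (τ₀ - δ) τ₀, g₀ s = z) ↔
      ¬ ((∀ s ∈ Ioo (τ₀ - δ) τ₀, g₀ s < z) ∨ (∀ s ∈ Ioo (τ₀ - δ) τ₀, z < g₀ s)) := by
  constructor
  · rintro ⟨s, hs, rfl⟩ (h | h) <;> exact lt_irrefl _ (h s hs)
  · intro h
    push Not at h
    obtain ⟨⟨s₁, hs₁, h₁⟩, s₂, hs₂, h₂⟩ := h
    have hsub : uIcc s₂ s₁ ⊆ Ioo (τ₀ - δ) τ₀ := ordConnected_Ioo.uIcc_subset hs₂ hs₁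
    have hivt := intermediate_value_uIcc (hc.mono (hsub.trans fun _ h ↦ h.2))
    obtain ⟨s, hs, hsz⟩ := hivt (mem_uIcc.2 (Or.inl ⟨h₂, h₁⟩))
    exact ⟨s, hsub hs, hsz⟩

end Window

/-! ### Measurability of the window events -/

section Measurable

variable {Ω : Type*} {m : MeasurableSpace Ω} {τ : Ω → ℝ≥0} {g : Ω → ℝ≥0 → ℝ}

/-- Membership of a fixed time in the random window is a measurable event. [folklore] -/
theorem measurable_mem_window (hτ : Measurable τ) (δ s : ℝ≥0) :
    Measurable fun ω ↦ s ∈ Ioo (τ ω - δ) (τ ω) := by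
  refine Measurable.and ?_ ?_
  · exact measurableSet_setOf.1 (measurableSet_lt (hτ.sub measurable_const) measurable_const)
  · exact measurableSet_setOf.1 (measurableSet_lt measurable_const hτ)

/-- "The path stays below `z` on the random window" is measurable (paths continuous before `τ`,
measurable at fixed times). [folklore] -/
theorem measurable_forall_window_lt (hτ : Measurable τ) (hg : ∀ s, Measurable fun ω ↦ g ω s)
    (hcont : ∀ ω, ContinuousOn (g ω) (Iio (τ ω))) (δ : ℝ≥0) (z : ℝ) :
    Measurable fun ω ↦ ∀ s ∈ Ioo (τ ω - δ) (τ ω), g ω s < z := by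
  have heq : (fun ω ↦ ∀ s ∈ Ioo (τ ω - δ) (τ ω), g ω s < z) = fun ω ↦
      ∀ a b : ℚ, ((a : ℝ)).toNNReal ∈ Ioo (τ ω - δ) (τ ω) →
        ((b : ℝ)).toNNReal ∈ Ioo (τ ω - δ) (τ ω) →
        ∃ k : ℕ, ∀ q : ℚ, ((q : ℝ)).toNNReal ∈ Icc ((a : ℝ)).toNNReal ((b : ℝ)).toNNReal →
          g ω ((q : ℝ)).toNNReal ≤ z - ((k : ℝ) + 1)⁻¹ := by
    funext ω
    exact propext (forall_window_lt_iff (hcont ω) z)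
  rw [heq]
  refine Measurable.forall fun a ↦ Measurable.forall fun b ↦ ?_
  refine (measurable_mem_window hτ δ _).imp ((measurable_mem_window hτ δ _).imp ?_)
  refine Measurable.exists fun k ↦ Measurable.forall fun q ↦ measurable_const.imp ?_
  exact measurableSet_setOf.1 (measurableSet_le (hg _) measurable_const)

/-- "The path stays above `z` on the random window" is measurable. [folklore] -/
theorem measurable_forall_window_gt (hτ : Measurable τ) (hg : ∀ s, Measurable fun ω ↦ g ω s)
    (hcont : ∀ ω, ContinuousOn (g ω) (Iio (τ ω))) (δ : ℝ≥0) (z : ℝ) :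
    Measurable fun ω ↦ ∀ s ∈ Ioo (τ ω - δ) (τ ω), z < g ω s := by
  have h := measurable_forall_window_lt (g := fun ω s ↦ -g ω s) hτ (fun s ↦ (hg s).neg)
    (fun ω ↦ (hcont ω).neg) δ (-z)
  have heq : (fun ω ↦ ∀ s ∈ Ioo (τ ω - δ) (τ ω), z < g ω s) =
      fun ω ↦ ∀ s ∈ Ioo (τ ω - δ) (τ ω), -g ω s < -z := by
    funext ω
    simp only [neg_lt_neg_iff]
  rw [heq]
  exact h

/-- "The path attains the value `z` on the random window" is measurable. [folklore] -/
theorem measurable_exists_window_eq (hτ : Measurable τ) (hg : ∀ s, Measurable fun ω ↦ g ω s)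
    (hcont : ∀ ω, ContinuousOn (g ω) (Iio (τ ω))) (δ : ℝ≥0) (z : ℝ) :
    Measurable fun ω ↦ ∃ s ∈ Ioo (τ ω - δ) (τ ω), g ω s = z := by
  have heq : (fun ω ↦ ∃ s ∈ Ioo (τ ω - δ) (τ ω), g ω s = z) = fun ω ↦
      ¬ ((∀ s ∈ Ioo (τ ω - δ) (τ ω), g ω s < z) ∨ (∀ s ∈ Ioo (τ ω - δ) (τ ω), z < g ω s)) := by
    funext ω
    exact propext (exists_window_eq_iff (hcont ω) z)
  rw [heq]
  exact ((measurable_forall_window_lt hτ hg hcont δ z).or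
    (measurable_forall_window_gt hτ hg hcont δ z)).not

end Measurable

/-! ### The left limit of `F ∘ g` at `τ`: a countable Cauchy criterion

The values of `F ∘ g₀` on a window are controlled by countably many *witnesses*, indexed by
`ℚ ⊕ Z`: a rational time in the window (`inl q`, carrying the value `F (g₀ q)`) and an
exceptional value `z ∈ Z` of `F` attained by `g₀` on the window (`inr z`, carrying `F z`).
The two `Sum.elim` expressions below are "witness `i` is present" and "the value it carries". -/

section Witness

variable {Z : Set ℝ} {F : ℝ → ℝ} {τ₀ δ : ℝ≥0} {g₀ : ℝ≥0 → ℝ}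

/-- Every witnessed value is a value of `F ∘ g₀` on the window. [folklore] -/
theorem exists_witVal_eq (i : ℚ ⊕ Z)
    (hi : Sum.elim (fun q : ℚ ↦ ((q : ℝ)).toNNReal ∈ Ioo (τ₀ - δ) τ₀)
      (fun z : Z ↦ ∃ s ∈ Ioo (τ₀ - δ) τ₀, g₀ s = z) i) :
    ∃ s ∈ Ioo (τ₀ - δ) τ₀,
      Sum.elim (fun q : ℚ ↦ F (g₀ ((q : ℝ)).toNNReal)) (fun z : Z ↦ F z) i = F (g₀ s) := by
  cases i with
  | inl q => exact ⟨_, hi, rfl⟩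
  | inr z =>
    obtain ⟨s, hs, h⟩ := hi
    exact ⟨s, hs, by rw [Sum.elim_inr, h]⟩

/-- Conversely every value of `F ∘ g₀` on the window is a limit of witnessed values, provided
`g₀` is continuous before `τ₀` and `F` is continuous off `Z`. [folklore] -/
theorem mem_closure_witVal (hF : ∀ y, y ∉ Z → ContinuousAt F y) (hc : ContinuousOn g₀ (Iio τ₀))
    {s : ℝ≥0} (hs : s ∈ Ioo (τ₀ - δ) τ₀) :
    F (g₀ s) ∈ closure {v | ∃ i : ℚ ⊕ Z,
      Sum.elim (fun q : ℚ ↦ ((q : ℝ)).toNNReal ∈ Ioo (τ₀ - δ) τ₀)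
        (fun z : Z ↦ ∃ s ∈ Ioo (τ₀ - δ) τ₀, g₀ s = z) i ∧
      Sum.elim (fun q : ℚ ↦ F (g₀ ((q : ℝ)).toNNReal)) (fun z : Z ↦ F z) i = v} := by
  by_cases hz : g₀ s ∈ Z
  · exact subset_closure ⟨Sum.inr ⟨g₀ s, hz⟩, ⟨s, hs, rfl⟩, rfl⟩
  · have hcs : ContinuousAt (fun u ↦ F (g₀ u)) s :=
      (hF _ hz).comp (hc.continuousAt (Iio_mem_nhds hs.2))
    have hcl : s ∈ closure (Ioo (τ₀ - δ) τ₀ ∩ range fun q : ℚ ↦ ((q : ℝ)).toNNReal) :=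
      dense_range_ratTime.open_subset_closure_inter isOpen_Ioo hs
    have hmem := hcs.continuousWithinAt.mem_closure_image hcl
    refine closure_mono ?_ hmem
    rintro _ ⟨d, ⟨hd, q, rfl⟩, rfl⟩
    exact ⟨Sum.inl q, hd, rfl⟩

/-- A set of reals of diameter `≤ r` has closure of diameter `≤ r`. [folklore] -/
theorem dist_le_of_mem_closure {W : Set ℝ} {r v w : ℝ} (hv : v ∈ closure W) (hw : w ∈ closure W)
    (h : ∀ v ∈ W, ∀ w ∈ W, dist v w ≤ r) : dist v w ≤ r := by
  have h1 : ∀ v ∈ closure W, ∀ w ∈ W, dist v w ≤ r := by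
    intro v hv w hw
    have hsub : closure W ⊆ Metric.closedBall w r :=
      closure_minimal (fun v' hv' ↦ Metric.mem_closedBall.2 (h v' hv' w hw))
        Metric.isClosed_closedBall
    exact Metric.mem_closedBall.1 (hsub hv)
  have hsub : closure W ⊆ Metric.closedBall v r :=
    closure_minimal (fun w' hw' ↦ Metric.mem_closedBall.2
      (by rw [dist_comm]; exact h1 v hv w' hw')) Metric.isClosed_closedBall
  have := Metric.mem_closedBall.1 (hsub hw)
  rwa [dist_comm] at this

/-- **Countable Cauchy criterion for the left limit of `F ∘ g₀` at `τ₀ > 0`** (path `g₀`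
continuous before `τ₀`, `F` continuous off the countable set `Z`): the left limit exists iff for
every `n` the witnessed values on some window of width `1/(m+1)` are pairwise `1/(n+1)`-close.
[folklore] -/
theorem exists_tendsto_comp_iff (hτ₀ : 0 < τ₀) (hF : ∀ y, y ∉ Z → ContinuousAt F y)
    (hc : ContinuousOn g₀ (Iio τ₀)) :
    (∃ c, Tendsto (fun s ↦ F (g₀ s)) (𝓝[<] τ₀) (𝓝 c)) ↔
      ∀ n : ℕ, ∃ m : ℕ, ∀ i j : ℚ ⊕ Z,
        Sum.elim (fun q : ℚ ↦ ((q : ℝ)).toNNReal ∈ Ioo (τ₀ - ((m : ℝ≥0) + 1)⁻¹) τ₀)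
          (fun z : Z ↦ ∃ s ∈ Ioo (τ₀ - ((m : ℝ≥0) + 1)⁻¹) τ₀, g₀ s = z) i →
        Sum.elim (fun q : ℚ ↦ ((q : ℝ)).toNNReal ∈ Ioo (τ₀ - ((m : ℝ≥0) + 1)⁻¹) τ₀)
          (fun z : Z ↦ ∃ s ∈ Ioo (τ₀ - ((m : ℝ≥0) + 1)⁻¹) τ₀, g₀ s = z) j →
        dist (Sum.elim (fun q : ℚ ↦ F (g₀ ((q : ℝ)).toNNReal)) (fun z : Z ↦ F z) i)
          (Sum.elim (fun q : ℚ ↦ F (g₀ ((q : ℝ)).toNNReal)) (fun z : Z ↦ F z) j) ≤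
          ((n : ℝ) + 1)⁻¹ := by
  constructor
  · rintro ⟨c, hc'⟩ n
    have hε : (0 : ℝ) < ((n : ℝ) + 1)⁻¹ / 2 := by positivity
    have hev : ∀ᶠ s in 𝓝[<] τ₀, dist (F (g₀ s)) c < ((n : ℝ) + 1)⁻¹ / 2 :=
      Metric.tendsto_nhds.1 hc' _ hε
    obtain ⟨m, hm⟩ := exists_window_subset hτ₀ hev
    refine ⟨m, fun i j hi hj ↦ ?_⟩
    obtain ⟨s, hs, hvi⟩ := exists_witVal_eq (F := F) i hi
    obtain ⟨s', hs', hvj⟩ := exists_witVal_eq (F := F) j hj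
    rw [hvi, hvj]
    have h1 : dist (F (g₀ s)) c < ((n : ℝ) + 1)⁻¹ / 2 := hm hs
    have h2 : dist (F (g₀ s')) c < ((n : ℝ) + 1)⁻¹ / 2 := hm hs'
    calc dist (F (g₀ s)) (F (g₀ s'))
        ≤ dist (F (g₀ s)) c + dist (F (g₀ s')) c := dist_triangle_right _ _ _
      _ ≤ ((n : ℝ) + 1)⁻¹ := by linarith
  · intro h
    haveI : (𝓝[<] τ₀).NeBot := nhdsLT_neBot_of_exists_lt ⟨0, hτ₀⟩
    refine cauchy_map_iff_exists_tendsto.1 (Metric.cauchy_iff.2 ⟨inferInstance, fun ε hε ↦ ?_⟩)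
    obtain ⟨n, hn⟩ := exists_nat_one_div_lt hε
    obtain ⟨m, hm⟩ := h n
    refine ⟨(fun s ↦ F (g₀ s)) '' Ioo (τ₀ - ((m : ℝ≥0) + 1)⁻¹) τ₀,
      image_mem_map (window_mem_nhdsLT hτ₀ (Nat.inv_pos_of_nat (n := m))), ?_⟩
    rintro _ ⟨s, hs, rfl⟩ _ ⟨s', hs', rfl⟩
    rw [one_div] at hn
    refine lt_of_le_of_lt ?_ hn
    refine dist_le_of_mem_closure (mem_closure_witVal hF hc hs) (mem_closure_witVal hF hc hs') ?_
    rintro v ⟨i, hi, rfl⟩ w ⟨j, hj, rfl⟩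
    exact hm i j hi hj

end Witness

/-! ### Measurability of the left limit at a random time -/

section LeftLimit

variable {Ω : Type*} {m : MeasurableSpace Ω} {τ : Ω → ℝ≥0} {g : Ω → ℝ≥0 → ℝ}
  {Z : Set ℝ} {F : ℝ → ℝ}

/-- The witness predicates are measurable in `ω`. [folklore] -/
theorem measurable_witIn (hτ : Measurable τ) (hg : ∀ s, Measurable fun ω ↦ g ω s)
    (hcont : ∀ ω, ContinuousOn (g ω) (Iio (τ ω))) (δ : ℝ≥0) (i : ℚ ⊕ Z) :
    Measurable fun ω ↦ Sum.elim (fun q : ℚ ↦ ((q : ℝ)).toNNReal ∈ Ioo (τ ω - δ) (τ ω))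
      (fun z : Z ↦ ∃ s ∈ Ioo (τ ω - δ) (τ ω), g ω s = z) i := by
  cases i with
  | inl q => exact measurable_mem_window hτ δ _
  | inr z => exact measurable_exists_window_eq hτ hg hcont δ z

/-- The witnessed values are measurable in `ω`. [folklore] -/
theorem measurable_witVal (hg : ∀ s, Measurable fun ω ↦ g ω s) (hFm : Measurable F)
    (i : ℚ ⊕ Z) :
    Measurable fun ω ↦ Sum.elim (fun q : ℚ ↦ F (g ω ((q : ℝ)).toNNReal)) (fun z : Z ↦ F z) i := by
  cases i with
  | inl q => exact hFm.comp (hg _)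
  | inr z => exact measurable_const

/-- **The event "the left limit of `F (g s)` at the random time `τ` exists" is measurable**
(paths continuous before `τ`, measurable at fixed times; `F` Borel and continuous off a
countable set). [folklore] -/
theorem measurableSet_exists_tendsto_comp (hτ : Measurable τ) (hg : ∀ s, Measurable fun ω ↦ g ω s)
    (hcont : ∀ ω, ContinuousOn (g ω) (Iio (τ ω))) (hZ : Z.Countable)
    (hF : ∀ y, y ∉ Z → ContinuousAt F y) (hFm : Measurable F) :
    MeasurableSet {ω | 0 < τ ω ∧ ∃ c, Tendsto (fun s ↦ F (g ω s)) (𝓝[<] τ ω) (𝓝 c)} := by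
  haveI := hZ.to_subtype
  have heq : {ω | 0 < τ ω ∧ ∃ c, Tendsto (fun s ↦ F (g ω s)) (𝓝[<] τ ω) (𝓝 c)} =
      {ω | 0 < τ ω ∧ ∀ n : ℕ, ∃ m : ℕ, ∀ i j : ℚ ⊕ Z,
        Sum.elim (fun q : ℚ ↦ ((q : ℝ)).toNNReal ∈ Ioo (τ ω - ((m : ℝ≥0) + 1)⁻¹) (τ ω))
          (fun z : Z ↦ ∃ s ∈ Ioo (τ ω - ((m : ℝ≥0) + 1)⁻¹) (τ ω), g ω s = z) i →
        Sum.elim (fun q : ℚ ↦ ((q : ℝ)).toNNReal ∈ Ioo (τ ω - ((m : ℝ≥0) + 1)⁻¹) (τ ω))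
          (fun z : Z ↦ ∃ s ∈ Ioo (τ ω - ((m : ℝ≥0) + 1)⁻¹) (τ ω), g ω s = z) j →
        dist (Sum.elim (fun q : ℚ ↦ F (g ω ((q : ℝ)).toNNReal)) (fun z : Z ↦ F z) i)
          (Sum.elim (fun q : ℚ ↦ F (g ω ((q : ℝ)).toNNReal)) (fun z : Z ↦ F z) j) ≤
          ((n : ℝ) + 1)⁻¹} := by
    ext ω
    simp only [mem_setOf_eq]
    exact and_congr_right fun hτ0 ↦ exists_tendsto_comp_iff hτ0 hF (hcont ω)
  rw [heq]
  refine measurableSet_setOf.2 ?_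
  refine (measurableSet_setOf.1 (measurableSet_lt measurable_const hτ)).and ?_
  refine Measurable.forall fun n ↦ Measurable.exists fun m ↦
    Measurable.forall fun i ↦ Measurable.forall fun j ↦ ?_
  refine (measurable_witIn hτ hg hcont _ i).imp ((measurable_witIn hτ hg hcont _ j).imp ?_)
  exact measurableSet_setOf.1 (measurableSet_le
    ((measurable_witVal hg hFm i).dist (measurable_witVal hg hFm j)) measurable_const)

/-- The path sampled at the random dyadic time `((⌈τ 2ᵏ⌉ - 1) / 2ᵏ)⁺` is measurable (the
sampling time takes its values in the countable grid `((j - 1) / 2ᵏ)⁺`, `j ∈ ℤ`). [folklore] -/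
theorem measurable_apply_dyTime (hτ : Measurable τ) (hg : ∀ s, Measurable fun ω ↦ g ω s)
    (k : ℕ) :
    Measurable fun ω ↦ g ω ((((⌈(τ ω : ℝ) * 2 ^ k⌉ : ℤ) : ℝ) - 1) / 2 ^ k).toNNReal := by
  have h1 : Measurable fun p : ℤ × Ω ↦ g p.2 ((((p.1 : ℤ) : ℝ) - 1) / 2 ^ k).toNNReal :=
    measurable_from_prod_countable_right fun j ↦ hg ((((j : ℤ) : ℝ) - 1) / 2 ^ k).toNNReal
  have h2 : Measurable fun ω ↦ (⌈(τ ω : ℝ) * 2 ^ k⌉, ω) :=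
    (Int.measurable_ceil.comp ((measurable_coe_nnreal_real.comp hτ).mul_const _)).prodMk
      measurable_id
  exact h1.comp h2

/-- **Measurability of the left limit at a random time.** Let `τ` be a measurable `ℝ≥0`-valued
time and `g ω` paths that are continuous on `[0, τ ω)` and measurable in `ω` at each fixed time;
let `F : ℝ → ℝ` be Borel and continuous off a countable set `Z`. Then
`ω ↦ limUnder (𝓝[<] τ ω) (fun s ↦ F (g ω s))` — the left limit of `F ∘ g ω` at `τ ω` when it
exists, Mathlib's junk value otherwise — is measurable. (Revuz–Yor (1999), Ch. I §4: left limits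
of adapted processes with regular paths; here for the raw σ-algebra and without any regularity
of `F ∘ g` itself.) [folklore] -/
theorem measurable_limUnder_nhdsLT_comp (hτ : Measurable τ) (hg : ∀ s, Measurable fun ω ↦ g ω s)
    (hcont : ∀ ω, ContinuousOn (g ω) (Iio (τ ω))) (hZ : Z.Countable)
    (hF : ∀ y, y ∉ Z → ContinuousAt F y) (hFm : Measurable F) :
    Measurable fun ω ↦ limUnder (𝓝[<] τ ω) (fun s ↦ F (g ω s)) := by
  classical
  set conv := {ω | 0 < τ ω ∧ ∃ c, Tendsto (fun s ↦ F (g ω s)) (𝓝[<] τ ω) (𝓝 c)} with hconv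
  have hconv_m : MeasurableSet conv := measurableSet_exists_tendsto_comp hτ hg hcont hZ hF hFm
  set A : ℕ → Ω → ℝ := fun k ω ↦
    F (g ω ((((⌈(τ ω : ℝ) * 2 ^ k⌉ : ℤ) : ℝ) - 1) / 2 ^ k).toNNReal) with hA
  have hA_m : ∀ k, Measurable (A k) := fun k ↦ hFm.comp (measurable_apply_dyTime hτ hg k)
  set cval : Ω → ℝ := fun ω ↦ limUnder atTop (fun k ↦ A k ω) with hcval
  have hc_m : Measurable cval :=
    (StronglyMeasurable.limUnder (fun k ↦ (hA_m k).stronglyMeasurable)).measurable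
  set junk₀ : ℝ := limUnder (⊥ : Filter ℝ≥0) (fun _ ↦ (0 : ℝ)) with hjunk
  have heq : (fun ω ↦ limUnder (𝓝[<] τ ω) (fun s ↦ F (g ω s))) = fun ω ↦
      if τ ω = 0 then junk₀ else if ω ∈ conv then cval ω
        else Classical.choice (inferInstance : Nonempty ℝ) := by
    funext ω
    by_cases h0 : τ ω = 0
    · rw [if_pos h0]
      have hbot : 𝓝[<] τ ω = ⊥ := by
        have : Iio (τ ω) = ∅ := by
          ext s
          simp [h0]
        rw [this]
        exact nhdsWithin_empty _
      rw [hbot]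
      simp [hjunk, Filter.limUnder, Filter.map_bot]
    · rw [if_neg h0]
      have hpos : 0 < τ ω := pos_iff_ne_zero.2 h0
      haveI : (𝓝[<] τ ω).NeBot := nhdsLT_neBot_of_exists_lt ⟨0, hpos⟩
      by_cases hcω : ω ∈ conv
      · rw [if_pos hcω]
        obtain ⟨c, hc'⟩ := hcω.2
        rw [hc'.limUnder_eq]
        exact ((hc'.comp (tendsto_dyTime hpos)).limUnder_eq).symm
      · rw [if_neg hcω]
        have : ¬ ∃ c, Tendsto (fun s ↦ F (g ω s)) (𝓝[<] τ ω) (𝓝 c) := fun h ↦ hcω ⟨hpos, h⟩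
        exact limUnder_of_not_tendsto this
  rw [heq]
  refine Measurable.ite ?_ measurable_const (Measurable.ite hconv_m hc_m measurable_const)
  exact hτ (measurableSet_singleton 0)

end LeftLimit

end LeftLimitAtTime

/-! ### Cardy's function is Borel, and continuous off `{1, -1}` -/

namespace CardyAdapted

/-- The terms of the hypergeometric series `₂F₁(1/3, 2/3; 4/3; x)` are the monomials
`cₙ xⁿ`. [folklore] -/
theorem cardySeries_apply (x : ℝ) (n : ℕ) :
    ordinaryHypergeometricSeries ℝ (1 / 3 : ℝ) (2 / 3) (4 / 3) n (fun _ ↦ x) =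
      ordinaryHypergeometricCoefficient (1 / 3 : ℝ) (2 / 3) (4 / 3) n * x ^ n := by
  rw [ordinaryHypergeometricSeries, FormalMultilinearSeries.ofScalars_apply_eq, smul_eq_mul]

/-- Each term of the hypergeometric series is a continuous (polynomial) function of `x`.
[folklore] -/
theorem continuous_cardySeries_apply (n : ℕ) :
    Continuous fun x : ℝ ↦ ordinaryHypergeometricSeries ℝ (1 / 3 : ℝ) (2 / 3) (4 / 3) n (fun _ ↦ x) := by
  simp_rw [cardySeries_apply]
  fun_prop

/-- `x ↦ ₂F₁(1/3, 2/3; 4/3; x)` (Mathlib's `tsum`, junk value `0` where the series diverges) is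
Borel measurable: a `tsum` of continuous functions (`StronglyMeasurable.tsum`). [folklore] -/
theorem measurable_cardyHypergeometric :
    Measurable (₂F₁ (1 / 3 : ℝ) (2 / 3 : ℝ) (4 / 3 : ℝ) : ℝ → ℝ) := by
  have : (₂F₁ (1 / 3 : ℝ) (2 / 3 : ℝ) (4 / 3 : ℝ) : ℝ → ℝ) = fun x ↦
      ∑' n, ordinaryHypergeometricSeries ℝ (1 / 3 : ℝ) (2 / 3) (4 / 3) n (fun _ ↦ x) := rfl
  rw [this]
  refine (StronglyMeasurable.tsum fun n ↦ ?_).measurable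
  exact (continuous_cardySeries_apply n).stronglyMeasurable

/-- **Cardy's function is Borel measurable on `ℝ`** (including its junk values outside `[0, 1]`).
[folklore] -/
theorem measurable_cardyFunction : Measurable cardyFunction := by
  unfold cardyFunction
  refine ((measurable_const.mul (measurable_id.pow_const _)).mul measurable_cardyHypergeometric)

/-- Outside `[-1, 1]` the hypergeometric series `₂F₁(1/3, 2/3; 4/3; x)` diverges (its radius of
convergence is `1`, `ordinaryHypergeometricSeries_cardy_radius_eq_one`; a summable series has
terms tending to `0`, `FormalMultilinearSeries.le_radius_of_tendsto`). [folklore] -/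
theorem not_summable_cardySeries {x : ℝ} (hx : 1 < |x|) :
    ¬ Summable fun n ↦ ordinaryHypergeometricSeries ℝ (1 / 3 : ℝ) (2 / 3) (4 / 3) n (fun _ ↦ x) := by
  intro hs
  set p := ordinaryHypergeometricSeries ℝ (1 / 3 : ℝ) (2 / 3) (4 / 3) with hp
  have h0 := hs.tendsto_atTop_zero
  have hr : Tendsto (fun n ↦ ‖p n‖ * ((‖x‖₊ : ℝ≥0) : ℝ) ^ n) atTop (𝓝 0) := by
    have : (fun n ↦ ‖p n‖ * ((‖x‖₊ : ℝ≥0) : ℝ) ^ n) = fun n ↦ ‖p n (fun _ ↦ x)‖ := by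
      funext n
      rw [hp, cardySeries_apply, ordinaryHypergeometricSeries,
        FormalMultilinearSeries.ofScalars_norm, coe_nnnorm, ← norm_pow, ← norm_mul]
    rw [this]
    exact (tendsto_zero_iff_norm_tendsto_zero.1 h0)
  have hle := p.le_radius_of_tendsto hr
  rw [hp, ordinaryHypergeometricSeries_cardy_radius_eq_one] at hle
  have : (‖x‖₊ : ℝ≥0) ≤ 1 := by exact_mod_cast hle
  have h2 : |x| ≤ 1 := by
    have := NNReal.coe_le_coe.2 this
    simpa using this
  linarith

/-- Hence `₂F₁(1/3, 2/3; 4/3; x) = 0` (junk value of `tsum`) for `|x| > 1`. [folklore] -/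
theorem cardyHypergeometric_eq_zero {x : ℝ} (hx : 1 < |x|) :
    ₂F₁ (1 / 3 : ℝ) (2 / 3 : ℝ) (4 / 3 : ℝ) x = 0 := by
  change ∑' n, ordinaryHypergeometricSeries ℝ (1 / 3 : ℝ) (2 / 3) (4 / 3) n (fun _ ↦ x) = 0
  exact tsum_eq_zero_of_not_summable (not_summable_cardySeries hx)

/-- `₂F₁(1/3, 2/3; 4/3; ·)` is continuous at every `x` with `|x| ≠ 1`: analytic on the open unit
ball, identically `0` on the open set `{|x| > 1}`. [folklore] -/
theorem continuousAt_cardyHypergeometric {x : ℝ} (hx : |x| ≠ 1) :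
    ContinuousAt (₂F₁ (1 / 3 : ℝ) (2 / 3 : ℝ) (4 / 3 : ℝ) : ℝ → ℝ) x := by
  rcases hx.lt_or_gt with h | h
  · have hball : x ∈ Metric.eball (0 : ℝ) 1 := by
      rw [Metric.mem_eball, edist_zero_right, ← ofReal_norm, Real.norm_eq_abs,
        ENNReal.ofReal_lt_one]
      exact h
    exact ((ordinaryHypergeometric_hasFPowerSeriesOnBall (𝔸 := ℝ) (1 / 3 : ℝ) (2 / 3) (4 / 3)
      cardy_params_ne_neg_nat).analyticOnNhd x hball).continuousAt
  · have hopen : IsOpen {y : ℝ | 1 < |y|} := isOpen_lt continuous_const continuous_abs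
    refine (continuousAt_const (y := (0 : ℝ))).congr ?_
    filter_upwards [hopen.mem_nhds h] with y hy
    exact (cardyHypergeometric_eq_zero hy).symm

/-- **Cardy's function is continuous at every `x ∉ {1, -1}`** (the real cube root is continuous
everywhere). At `±1` it has genuine jumps (`tsum` junk outside the disc of convergence), which
is why the adaptedness proof below allows a countable exceptional set. [folklore] -/
theorem continuousAt_cardyFunction {x : ℝ} (hx : |x| ≠ 1) : ContinuousAt cardyFunction x := by
  unfold cardyFunction
  refine (continuousAt_const.mul ?_).mul (continuousAt_cardyHypergeometric hx)
  exact Real.continuousAt_rpow_const x _ (Or.inr (by norm_num))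

end CardyAdapted

/-! ### The real SLE flow: measurability at fixed times and continuity of the cross-ratio path -/

namespace CardyAdapted

open Loewner

variable (κ : ℝ≥0)

/-- **The real SLE flow at a fixed time is `𝓕ᵂ_t`-measurable**, junk values included: for every
real `y` and `s ≤ t`, `ω ↦ re gₛ(y)` is `𝓕ᵂ_t`-measurable (on `{s < T_y}` it is the adapted real
flow of `SLEAdaptedProofs.measurable_realFlow_sle`, elsewhere `Loewner.map` returns `y`).
Lawler (2005), §4.1. [cite: Lawler2005, Ch. 4 §4.1] -/
theorem measurable_re_sleMap_of_le (y : ℝ) {s t : ℝ≥0} (hs : s ≤ t) :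
    Measurable[brownianFiltration t] fun ω ↦ (sleMap κ ω s y).re := by
  by_cases hy : y = 0
  · subst hy
    have h : (fun ω ↦ (sleMap κ ω s (0 : ℝ)).re) = fun _ ↦ 0 := by
      funext ω
      have hns : ¬ (s : WithTop ℝ≥0) < swallowingTime (sleDriving κ ω) ((0 : ℝ) : ℂ) := by
        rw [swallowingTime_sleDriving_zero]
        exact not_lt.2 bot_le
      rw [sleMap, map_of_not_lt_swallowingTime hns]
      simp
    rw [h]
    exact measurable_const
  · have h1 := measurable_realFlow_sle κ hy s
    have h2 : Measurable[brownianFiltration t] fun ω ↦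
        if (s : WithTop ℝ≥0) < swallowingTime (sleDriving κ ω) y then sleDriving κ ω s else y :=
      Measurable.ite (brownianFiltration.mono hs _ (measurableSet_lt_swallowingTime_sle κ hy s))
        (measurable_sleDriving_of_le κ hs) measurable_const
    have heq : (fun ω ↦ (sleMap κ ω s y).re) = fun ω ↦
        (if (s : WithTop ℝ≥0) < swallowingTime (sleDriving κ ω) y then
          (map (sleDriving κ ω) s y).re - sleDriving κ ω s else 0) +
        (if (s : WithTop ℝ≥0) < swallowingTime (sleDriving κ ω) y then sleDriving κ ω s
          else y) := by
      funext ω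
      split_ifs with h
      · simp [sleMap]
      · rw [sleMap, map_of_not_lt_swallowingTime h, Complex.ofReal_re, zero_add]
    rw [heq]
    exact (h1.mono (brownianFiltration.mono hs) le_rfl).add h2

/-- Cardy's cross-ratio of the flowed marks, written out. [folklore] -/
theorem cardyCrossRatio_eq (x : Fin 3 → ℝ) (s : ℝ≥0) (ω : ℝ≥0 → ℝ) :
    cardyCrossRatio κ x s ω =
      (sleDriving κ ω s - (sleMap κ ω s (x 0)).re) *
          ((sleMap κ ω s (x 1)).re - (sleMap κ ω s (x 2)).re) /
        ((sleDriving κ ω s - (sleMap κ ω s (x 1)).re) *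
          ((sleMap κ ω s (x 0)).re - (sleMap κ ω s (x 2)).re)) := by
  simp [cardyCrossRatio, crossRatio]

/-- **Cardy's cross-ratio process at a fixed time `s ≤ t` is `𝓕ᵂ_t`-measurable** (junk values
included): a rational function of `W_s` and the `re gₛ(xᵢ)`. Lawler (2005), §4.1 and §6.2.
[cite: Lawler2005, Ch. 4 §4.1] -/
theorem measurable_cardyCrossRatio_of_le (x : Fin 3 → ℝ) {s t : ℝ≥0} (hs : s ≤ t) :
    Measurable[brownianFiltration t] (cardyCrossRatio κ x s) := by
  have hW := measurable_sleDriving_of_le κ hs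
  have h0 := measurable_re_sleMap_of_le κ (x 0) hs
  have h1 := measurable_re_sleMap_of_le κ (x 1) hs
  have h2 := measurable_re_sleMap_of_le κ (x 2) hs
  have heq : cardyCrossRatio κ x s = fun ω ↦
      (sleDriving κ ω s - (sleMap κ ω s (x 0)).re) *
          ((sleMap κ ω s (x 1)).re - (sleMap κ ω s (x 2)).re) /
        ((sleDriving κ ω s - (sleMap κ ω s (x 1)).re) *
          ((sleMap κ ω s (x 0)).re - (sleMap κ ω s (x 2)).re)) :=
    funext (cardyCrossRatio_eq κ x s)
  rw [heq]
  exact ((hW.sub h0).mul (h1.sub h2)).div ((hW.sub h1).mul (h0.sub h2))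

/-- **The cross-ratio path is continuous before the first swallowing time.** If no mark is the
driving point `0`, then for every sample path `ω` the map `s ↦ η_s(ω)` is continuous on
`{s | s < T(ω)}`: the real flows `s ↦ gₛ(xᵢ)` are continuous there (`continuousOn_map_left`),
`gₛ(x₁) ≠ W_s` (`IsSolution.ne`), and `gₛ(x₀) ≠ gₛ(x₂)` unless `x₀ = x₂`
(`injOn_map_of_lt_swallowingTime`), in which case the cross-ratio is identically `0`.
Lawler (2005), §4.1. [cite: Lawler2005, Ch. 4 §4.1] -/
theorem continuousOn_cardyCrossRatio (x : Fin 3 → ℝ) (hx : ∀ i, x i ≠ 0) (ω : ℝ≥0 → ℝ) :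
    ContinuousOn (fun s ↦ cardyCrossRatio κ x s ω)
      {s | (s : WithTop ℝ≥0) < swallowingStoppingTime κ x ω} := by
  have hW : Continuous (sleDriving κ ω) := continuous_sleDriving κ ω
  have hW0 : sleDriving κ ω 0 = 0 := sleDriving_zero κ ω
  set S := {s : ℝ≥0 | (s : WithTop ℝ≥0) < swallowingStoppingTime κ x ω} with hSdef
  have hS : ∀ i, ∀ s ∈ S, (s : WithTop ℝ≥0) < swallowingTime (sleDriving κ ω) (x i) :=
    fun i s hs ↦ lt_of_lt_of_le hs (swallowingStoppingTime_le_swallowingTime κ x ω i)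
  have hxW : ∀ i, ((x i : ℝ) : ℂ) ≠ sleDriving κ ω 0 := fun i ↦ by
    rw [hW0]
    exact_mod_cast hx i
  have hg : ∀ i, ContinuousOn (fun s : ℝ≥0 ↦ (sleMap κ ω s (x i)).re) S := fun i ↦
    Complex.continuous_re.comp_continuousOn ((continuousOn_map_left hW (hxW i)).mono (hS i))
  have hWc : ContinuousOn (fun s : ℝ≥0 ↦ sleDriving κ ω s) S := hW.continuousOn
  -- the flowed marks are real (`IsSolution.im_eq_zero_holds`) ...
  have him : ∀ i, ∀ s ∈ S, (sleMap κ ω s (x i)).im = 0 := fun i s hs ↦ by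
    obtain ⟨g, hg⟩ := exists_isSolution_swallowingTime_holds hW (hxW i)
    rw [sleMap, map_eq_of_isSolution hW hg (hS i s hs)]
    exact IsSolution.im_eq_zero_holds hg (Complex.ofReal_im (x i)) s s.coe_nonneg
      (by simpa using hS i s hs)
  -- ... and stay off the driving function before being swallowed (`IsSolution.ne`)
  have hne1 : ∀ s ∈ S, sleDriving κ ω s - (sleMap κ ω s (x 1)).re ≠ 0 := by
    intro s hs h
    obtain ⟨g, hg⟩ := exists_isSolution_swallowingTime_holds hW (hxW 1)
    have hgs : g s ≠ sleDriving κ ω s := by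
      simpa using hg.ne (t := s) s.coe_nonneg (by simpa using hS 1 s hs)
    apply hgs
    rw [← map_eq_of_isSolution hW hg (hS 1 s hs)]
    apply Complex.ext
    · rw [Complex.ofReal_re]
      exact (sub_eq_zero.1 h).symm
    · rw [Complex.ofReal_im]
      exact him 1 s hs
  by_cases h02 : x 0 = x 2
  · have hzero : ∀ s ∈ S, cardyCrossRatio κ x s ω = 0 := fun s _ ↦ by
      rw [cardyCrossRatio_eq, h02, sub_self, mul_zero, div_zero]
    exact continuousOn_const.congr hzero
  · have hne2 : ∀ s ∈ S, (sleMap κ ω s (x 0)).re - (sleMap κ ω s (x 2)).re ≠ 0 := by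
      intro s hs h
      apply h02
      have heq : sleMap κ ω s (x 0) = sleMap κ ω s (x 2) :=
        Complex.ext (sub_eq_zero.1 h) (by rw [him 0 s hs, him 2 s hs])
      exact_mod_cast injOn_map_of_lt_swallowingTime hW s (hS 0 s hs) (hS 2 s hs) heq
    have heq : ∀ s ∈ S, cardyCrossRatio κ x s ω =
        (sleDriving κ ω s - (sleMap κ ω s (x 0)).re) *
            ((sleMap κ ω s (x 1)).re - (sleMap κ ω s (x 2)).re) /
          ((sleDriving κ ω s - (sleMap κ ω s (x 1)).re) *
            ((sleMap κ ω s (x 0)).re - (sleMap κ ω s (x 2)).re)) :=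
      fun s _ ↦ cardyCrossRatio_eq κ x s ω
    refine ContinuousOn.congr ?_ heq
    exact ((hWc.sub (hg 0)).mul ((hg 1).sub (hg 2))).div ((hWc.sub (hg 1)).mul ((hg 0).sub (hg 2)))
      fun s hs ↦ mul_ne_zero (hne1 s hs) (hne2 s hs)

/-- If one of the marks is the driving point `0`, the first swallowing time is `0` for every
path (`T_0 = 0`). [folklore] -/
theorem swallowingStoppingTime_eq_zero_of_eq_zero (x : Fin 3 → ℝ) {i : Fin 3} (hi : x i = 0)
    (ω : ℝ≥0 → ℝ) : swallowingStoppingTime κ x ω = 0 := by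
  apply le_antisymm _ bot_le
  have h := swallowingStoppingTime_le_swallowingTime κ x ω i
  rwa [hi, swallowingTime_sleDriving_zero] at h

/-- Times before the frozen clock `min T t`: `s < untopA (min T t) ↔ s < T ∧ s < t`. [folklore] -/
theorem lt_untopA_min_coe_iff {s t : ℝ≥0} {T : WithTop ℝ≥0} :
    s < (min T (t : WithTop ℝ≥0)).untopA ↔ (s : WithTop ℝ≥0) < T ∧ s < t := by
  have hne : min T (t : WithTop ℝ≥0) ≠ ⊤ := ne_top_of_le_ne_top WithTop.coe_ne_top (min_le_right _ _)
  rw [WithTop.lt_untopA_iff hne, lt_min_iff, WithTop.coe_lt_coe]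

end CardyAdapted

/-! ### crit-perc.S22: the Cardy observable is adapted -/

open Loewner in
/-- **The Cardy observable of SLE_κ is strongly adapted to the Brownian filtration** — discharge
of the named fact `Literature.Probability.RandomPlanarGeometry.stronglyAdapted_cardyObservable`
of `SLEMartingale` (crit-perc.S22), for *every* `κ` and *every* mark vector `x : Fin 3 → ℝ`.
On `{t < T} ∈ 𝓕ᵂ_t` the observable is `F(ηₜ)` with `ηₜ` an `𝓕ᵂ_t`-measurable function of the
flowed marks (`CardyAdapted.measurable_cardyCrossRatio_of_le`) and `F` Borel
(`CardyAdapted.measurable_cardyFunction`); on `{T ≤ t}` it is the left limit of `s ↦ F(η_s)` at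
the `𝓕ᵂ_t`-measurable time `T = min T t`, measurable by
`LeftLimitAtTime.measurable_limUnder_nhdsLT_comp` (paths `s ↦ η_s` continuous on `[0, T)`,
`CardyAdapted.continuousOn_cardyCrossRatio`; `F` continuous off `{1, -1}`,
`CardyAdapted.continuousAt_cardyFunction`). Lawler (2005), §4.1 and §6.2 (`gₜ(x)`, `T_x` and
the observable are functionals of the driving function up to time `t`); Lawler–Schramm–Werner,
Acta Math. 187 (2001), §3; Revuz–Yor (1999), Ch. I §4. [cite: Lawler2005, Ch. 4 §4.1] -/
theorem stronglyAdapted_cardyObservable_holds :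
    ∀ (κ : ℝ≥0) (x : Fin 3 → ℝ), stronglyAdapted_cardyObservable κ x := by
  intro κ x t
  refine Measurable.stronglyMeasurable ?_
  set T := swallowingStoppingTime κ x with hTdef
  have hT : IsStoppingTime brownianFiltration T := isStoppingTime_swallowingStoppingTime_holds κ x
  -- the frozen clock `τ = min T t`, an `𝓕ᵂ_t`-measurable `ℝ≥0`-valued time
  set τ : (ℝ≥0 → ℝ) → ℝ≥0 := fun ω ↦ (min (T ω) (t : WithTop ℝ≥0)).untopA with hτdef
  have hτm : Measurable[brownianFiltration t] τ :=
    ((hT.min_const t).measurable_of_le fun ω ↦ min_le_right _ _).untopA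
  -- the cross-ratio path, frozen after time `t`
  set g : (ℝ≥0 → ℝ) → ℝ≥0 → ℝ := fun ω s ↦ cardyCrossRatio κ x (min s t) ω with hgdef
  have hgm : ∀ s, Measurable[brownianFiltration t] fun ω ↦ g ω s := fun s ↦
    CardyAdapted.measurable_cardyCrossRatio_of_le κ x (min_le_right s t)
  have hIio : ∀ ω, ∀ s ∈ Iio (τ ω), (s : WithTop ℝ≥0) < T ω ∧ s < t := fun ω s hs ↦
    CardyAdapted.lt_untopA_min_coe_iff.1 hs
  have hgeq : ∀ ω, ∀ s ∈ Iio (τ ω), g ω s = cardyCrossRatio κ x s ω := fun ω s hs ↦ by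
    simp only [hgdef, min_eq_left ((hIio ω s hs).2).le]
  have hcont : ∀ ω, ContinuousOn (g ω) (Iio (τ ω)) := by
    by_cases hx : ∀ i, x i ≠ 0
    · intro ω
      refine ContinuousOn.congr ?_ (hgeq ω)
      exact (CardyAdapted.continuousOn_cardyCrossRatio κ x hx ω).mono fun s hs ↦ (hIio ω s hs).1
    · push Not at hx
      obtain ⟨i, hi⟩ := hx
      intro ω
      have hT0 : T ω = 0 := CardyAdapted.swallowingStoppingTime_eq_zero_of_eq_zero κ x hi ω
      have hτ0 : τ ω = 0 := by
        have h0t : (0 : WithTop ℝ≥0) ≤ (t : WithTop ℝ≥0) := bot_le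
        simp only [hτdef, hT0, min_eq_left h0t]
        rfl
      rw [hτ0]
      have : Iio (0 : ℝ≥0) = ∅ := by
        ext s
        simp
      rw [this]
      exact continuousOn_empty _
  -- Cardy's function: Borel, continuous off `{1, -1}`
  have hZ : ({1, -1} : Set ℝ).Countable := ((Set.finite_singleton (-1 : ℝ)).insert 1).countable
  have hF : ∀ y : ℝ, y ∉ ({1, -1} : Set ℝ) → ContinuousAt cardyFunction y := by
    intro y hy
    refine CardyAdapted.continuousAt_cardyFunction fun h ↦ hy ?_
    rcases (abs_eq zero_le_one).1 h with h | h
    · exact Or.inl h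
    · exact Or.inr h
  have hL : Measurable[brownianFiltration t] fun ω ↦
      limUnder (𝓝[<] τ ω) (fun s ↦ cardyFunction (g ω s)) :=
    LeftLimitAtTime.measurable_limUnder_nhdsLT_comp (m := brownianFiltration t) hτm hgm hcont hZ
      hF CardyAdapted.measurable_cardyFunction
  -- the observable, rewritten through the frozen clock and path
  have heq : cardyObservable κ x t = fun ω ↦
      if (t : WithTop ℝ≥0) < T ω then cardyFunction (cardyCrossRatio κ x t ω)
      else limUnder (𝓝[<] τ ω) (fun s ↦ cardyFunction (g ω s)) := by
    funext ω
    by_cases ht : (t : WithTop ℝ≥0) < T ω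
    · rw [cardyObservable_of_lt ht, if_pos ht]
    · rw [cardyObservable_of_le (not_lt.1 ht), if_neg ht]
      have hτω : (T ω).untopA = τ ω := by
        simp only [hτdef, min_eq_left (not_lt.1 ht)]
      rw [hτω]
      unfold Filter.limUnder
      rw [Filter.map_congr]
      exact Filter.eventually_of_mem self_mem_nhdsWithin fun s hs ↦ by simp only [hgeq ω s hs]
  rw [heq]
  exact Measurable.ite (hT.measurableSet_gt t)
    (CardyAdapted.measurable_cardyFunction.comp
      (CardyAdapted.measurable_cardyCrossRatio_of_le κ x le_rfl)) hL

end Literature.Probability.RandomPlanarGeometry
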